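import Mathlib.Analysis.SpecialFunctions.Log.Deriv
import Mathlib.Analysis.SpecialFunctions.Integrals.Basic
import Mathlib.Analysis.Complex.ExponentialBounds
import HarnessLib

/-!
# The switching constant in Chen's theorem: `c = ∫_{1/8}^{1/3} log(2-3β)/(β(1-β)) dβ < 2 log 3 - log 6`

Nathanson, *Additive Number Theory: The Classical Bases* (GTM 164), §10.6, proof of Thm 10.6,
defines the constant
`c = ∫_{1/8}^{1/3} log(2 - 3β) / (β(1 - β)) dβ = 0.363…`
(it is the coefficient of `e^γ/2 · N V(z)/log N` in the upper bound for the switched sifting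
function `S(B, 𝒫, y)`), and §10.8 concludes the proof of Chen's theorem (Thm 10.1) from the
numerical fact `2 log 3 - log 6 - c = 0.042… > 0`.

This file PROVES that numerical fact (`Literature.NumberTheory.Sieve.Chen.switchingIntegral_lt`):
`∫_{1/8}^{1/3} log(2 - 3β)/(β(1 - β)) dβ < 2 log 3 - log 6`.

Proof. For `t ≥ 0`, `log(1 + t) ≤ t - t²/2 + t³/3` (the derivative of the difference is
`t³/(1 + t) ≥ 0`; `log_one_add_le_cubic`). With `t = 1 - 3β ∈ [0, 5/8]` on `[1/8, 1/3]` this gives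
the pointwise bound
`log(2 - 3β)/(β(1 - β)) ≤ (5/6 - 3β + 9β²/2 - 9β³)/(β(1 - β)) = 9β + 9/2 + (5/6)/β - (20/3)/(1 - β)`,
whose integral over `[1/8, 1/3]` is `495/1152 + 15/16 + (5/6) log(8/3) - (20/3) log(21/16)`
`= 0.3716…`. Finally `0.3716… < 0.4054… = log(3/2)` is certified from Mathlib's bounds
`0.6931471803 < log 2 < 0.6931471808` and the lower bounds `log(3/2) > 0.40546`,
`log(7/4) > 0.55958` obtained from three terms of the series
`½ log((1+x)/(1-x)) = ∑ x^{2i+1}/(2i+1)` at `x = 1/5` and `x = 3/11` (`Real.sum_range_le_log_div`).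

## References

* M. B. Nathanson, *Additive Number Theory: The Classical Bases*, GTM 164, Springer (1996),
  §10.6 (definition of `c`, p. 290 of the printed book) and §10.8 ("`2 log 3 - log 6 - c = 0.042… > 0`").
  [Nathanson1996]
* Chen Jing-run, *On the representation of a larger even integer as the sum of a prime and the
  product of at most two primes*, Sci. Sinica 16 (1973) 157–176. [ChenSciSinica1973]
-/

noncomputable section

open Real Set intervalIntegral

namespace Literature.NumberTheory.Sieve.Chen

/-! ### The pointwise bound `log (1 + t) ≤ t - t²/2 + t³/3` -/

/-- `log (1 + t) ≤ t - t²/2 + t³/3` for `t ≥ 0`: the difference vanishes at `0` and has derivative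
`t³/(1+t) ≥ 0`. [folklore] -/
theorem log_one_add_le_cubic {t : ℝ} (ht : 0 ≤ t) :
    Real.log (1 + t) ≤ t - t ^ 2 / 2 + t ^ 3 / 3 := by
  let F : ℝ → ℝ := fun s => s - s ^ 2 / 2 + s ^ 3 / 3 - Real.log (1 + s)
  let F' : ℝ → ℝ := fun s => s ^ 3 / (1 + s)
  have A : ∀ s : ℝ, 0 ≤ s → HasDerivAt F (F' s) s := by
    intro s hs
    have h1 : (1 + s) ≠ 0 := by positivity
    have h : HasDerivAt F (1 - (↑2 * s ^ (2 - 1)) / 2 + (↑3 * s ^ (3 - 1)) / 3 - 1 / (1 + s)) s := by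
      refine (((hasDerivAt_id s).sub ((hasDerivAt_pow 2 s).div_const 2)).add
        ((hasDerivAt_pow 3 s).div_const 3)).sub ?_
      have := ((hasDerivAt_id s).const_add 1).log h1
      simpa using this
    convert h using 1
    simp only [F']
    field_simp
    ring
  suffices MonotoneOn F (Ici 0) by
    have h := this (self_mem_Ici) (mem_Ici.mpr ht) ht
    simp only [F] at h
    norm_num at h
    linarith
  refine monotoneOn_of_hasDerivWithinAt_nonneg (convex_Ici 0)
    (fun s hs => (A s hs).continuousAt.continuousWithinAt)
    (fun s hs => (A s (interior_subset hs)).hasDerivWithinAt) ?_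
  intro s hs
  rw [interior_Ici, Set.mem_Ioi] at hs
  simp only [F']
  positivity

/-! ### The integrand and its rational majorant -/

/-- On `[1/8, 1/3]`: `log(2 - 3β)/(β(1-β)) ≤ 9β + 9/2 + (5/6)/β - (20/3)/(1-β)`
(from `log_one_add_le_cubic` with `t = 1 - 3β`). [cite: Nathanson1996, §10.8] -/
theorem switchingIntegrand_le {β : ℝ} (h1 : 1 / 8 ≤ β) (h2 : β ≤ 1 / 3) :
    Real.log (2 - 3 * β) / (β * (1 - β)) ≤ 9 * β + 9 / 2 + 5 / 6 / β - 20 / 3 / (1 - β) := by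
  have hβ : 0 < β := by linarith
  have hβ' : 0 < 1 - β := by linarith
  have ht : 0 ≤ 1 - 3 * β := by linarith
  have hlog := log_one_add_le_cubic ht
  have h2eq : (1 : ℝ) + (1 - 3 * β) = 2 - 3 * β := by ring
  rw [h2eq] at hlog
  have hden : 0 < β * (1 - β) := mul_pos hβ hβ'
  have key : 9 * β + 9 / 2 + 5 / 6 / β - 20 / 3 / (1 - β) =
      ((1 - 3 * β) - (1 - 3 * β) ^ 2 / 2 + (1 - 3 * β) ^ 3 / 3) / (β * (1 - β)) := by
    field_simp
    ring
  rw [key]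
  exact div_le_div_of_nonneg_right hlog hden.le

/-- The integrand `log(2 - 3β)/(β(1-β))` is continuous on `[1/8, 1/3]`. [folklore] -/
theorem continuousOn_switchingIntegrand :
    ContinuousOn (fun β : ℝ => Real.log (2 - 3 * β) / (β * (1 - β))) (Icc (1 / 8) (1 / 3)) := by
  refine ContinuousOn.div ?_ (by fun_prop) ?_
  · refine ContinuousOn.log (by fun_prop) ?_
    intro x hx
    have := hx.2
    intro h0
    linarith
  · intro x hx h0
    rcases mul_eq_zero.mp h0 with h | h <;> linarith [hx.1, hx.2]

/-- The majorant `9β + 9/2 + (5/6)/β - (20/3)/(1-β)` is continuous on `[1/8, 1/3]`. [folklore] -/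
theorem continuousOn_switchingMajorant :
    ContinuousOn (fun β : ℝ => 9 * β + 9 / 2 + 5 / 6 / β - 20 / 3 / (1 - β)) (Icc (1 / 8) (1 / 3)) := by
  refine ContinuousOn.sub (ContinuousOn.add (by fun_prop) ?_) ?_
  · refine ContinuousOn.div (by fun_prop) (by fun_prop) ?_
    intro x hx h0
    linarith [hx.1]
  · refine ContinuousOn.div (by fun_prop) (by fun_prop) ?_
    intro x hx h0
    linarith [hx.2]

/-- `∫_{1/8}^{1/3} (9β + 9/2 + (5/6)/β - (20/3)/(1-β)) dβ
  = 495/1152 + 15/16 + (5/6) log(8/3) - (20/3) log(21/16)`. [folklore] -/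
theorem integral_switchingMajorant :
    ∫ β in (1 / 8 : ℝ)..(1 / 3), (9 * β + 9 / 2 + 5 / 6 / β - 20 / 3 / (1 - β)) =
      495 / 1152 + 15 / 16 + 5 / 6 * Real.log (8 / 3) - 20 / 3 * Real.log (21 / 16) := by
  have hI : ∀ {f : ℝ → ℝ}, ContinuousOn f (Icc (1 / 8) (1 / 3)) →
      IntervalIntegrable f MeasureTheory.volume (1 / 8 : ℝ) (1 / 3) := fun hf =>
    hf.intervalIntegrable_of_Icc (by norm_num)
  have c1 : ContinuousOn (fun β : ℝ => 9 * β) (Icc (1 / 8) (1 / 3)) := by fun_prop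
  have c2 : ContinuousOn (fun _ : ℝ => (9 / 2 : ℝ)) (Icc (1 / 8) (1 / 3)) := by fun_prop
  have c3 : ContinuousOn (fun β : ℝ => 5 / 6 / β) (Icc (1 / 8) (1 / 3)) := by
    refine ContinuousOn.div (by fun_prop) (by fun_prop) ?_
    intro x hx h0; linarith [hx.1]
  have c4 : ContinuousOn (fun β : ℝ => 20 / 3 / (1 - β)) (Icc (1 / 8) (1 / 3)) := by
    refine ContinuousOn.div (by fun_prop) (by fun_prop) ?_
    intro x hx h0; linarith [hx.2]
  rw [integral_sub ((hI c1).add (hI c2) |>.add (hI c3)) (hI c4),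
    integral_add ((hI c1).add (hI c2)) (hI c3), integral_add (hI c1) (hI c2)]
  -- the four pieces
  have e1 : ∫ β in (1 / 8 : ℝ)..(1 / 3), 9 * β = 9 * (((1 / 3 : ℝ) ^ 2 - (1 / 8) ^ 2) / 2) := by
    rw [intervalIntegral.integral_const_mul, integral_id]
  have e2 : ∫ _ in (1 / 8 : ℝ)..(1 / 3), (9 / 2 : ℝ) = ((1 / 3 : ℝ) - 1 / 8) • (9 / 2 : ℝ) :=
    integral_const _
  have e3 : ∫ β in (1 / 8 : ℝ)..(1 / 3), 5 / 6 / β = 5 / 6 * Real.log (8 / 3) := by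
    have : (fun β : ℝ => 5 / 6 / β) = fun β => 5 / 6 * (1 / β) := by
      funext β; ring
    rw [this, intervalIntegral.integral_const_mul, integral_one_div]
    · norm_num
    · norm_num [uIcc_of_le]
  have e4 : ∫ β in (1 / 8 : ℝ)..(1 / 3), 20 / 3 / (1 - β) = 20 / 3 * Real.log (21 / 16) := by
    have : (fun β : ℝ => 20 / 3 / (1 - β)) = fun β => 20 / 3 * ((fun u : ℝ => 1 / u) (1 - β)) := by
      funext β; ring
    rw [this, intervalIntegral.integral_const_mul,
      intervalIntegral.integral_comp_sub_left (fun u : ℝ => 1 / u) (1 : ℝ), integral_one_div]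
    · norm_num
    · norm_num [uIcc_of_le]
  rw [e1, e2, e3, e4]
  norm_num

/-- Lower bound `log(3/2) > 0.40546` from three terms of the `artanh` series at `x = 1/5`.
[folklore] -/
theorem log_three_halves_gt : (0.40546 : ℝ) < Real.log (3 / 2) := by
  have h := Real.sum_range_le_log_div (x := 1 / 5) (by norm_num) (by norm_num) 3
  norm_num [Finset.sum_range_succ] at h
  linarith

/-- Lower bound `log(7/4) > 0.55958` from three terms of the `artanh` series at `x = 3/11`.
[folklore] -/
theorem log_seven_fourths_gt : (0.55958 : ℝ) < Real.log (7 / 4) := by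
  have h := Real.sum_range_le_log_div (x := 3 / 11) (by norm_num) (by norm_num) 3
  norm_num [Finset.sum_range_succ] at h
  linarith

/-- **The numerical fact of Nathanson §10.8**: `c = ∫_{1/8}^{1/3} log(2-3β)/(β(1-β)) dβ < 2 log 3 - log 6`
(printed: `2 log 3 - log 6 - c = 0.042… > 0`, `c = 0.363…`). [cite: Nathanson1996, §10.8] -/
theorem switchingIntegral_lt :
    (∫ β in (1 / 8 : ℝ)..(1 / 3), Real.log (2 - 3 * β) / (β * (1 - β))) <
      2 * Real.log 3 - Real.log 6 := by
  have hmono : (∫ β in (1 / 8 : ℝ)..(1 / 3), Real.log (2 - 3 * β) / (β * (1 - β))) ≤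
      ∫ β in (1 / 8 : ℝ)..(1 / 3), (9 * β + 9 / 2 + 5 / 6 / β - 20 / 3 / (1 - β)) :=
    integral_mono_on (by norm_num)
      (continuousOn_switchingIntegrand.intervalIntegrable_of_Icc (by norm_num))
      (continuousOn_switchingMajorant.intervalIntegrable_of_Icc (by norm_num))
      (fun β hβ => switchingIntegrand_le hβ.1 hβ.2)
  rw [integral_switchingMajorant] at hmono
  -- express everything through `log 2`, `log 3`, `log 7`
  have h83 : Real.log (8 / 3) = 3 * Real.log 2 - Real.log 3 := by
    rw [Real.log_div (by norm_num) (by norm_num)]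
    rw [show (8 : ℝ) = 2 ^ 3 by norm_num, Real.log_pow]
    norm_num
  have h2116 : Real.log (21 / 16) = Real.log 3 + Real.log 7 - 4 * Real.log 2 := by
    rw [Real.log_div (by norm_num) (by norm_num)]
    rw [show (21 : ℝ) = 3 * 7 by norm_num, Real.log_mul (by norm_num) (by norm_num),
      show (16 : ℝ) = 2 ^ 4 by norm_num, Real.log_pow]
    norm_num
  have h6 : Real.log 6 = Real.log 2 + Real.log 3 := by
    rw [show (6 : ℝ) = 2 * 3 by norm_num, Real.log_mul (by norm_num) (by norm_num)]
  have h32 : Real.log (3 / 2) = Real.log 3 - Real.log 2 :=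
    Real.log_div (by norm_num) (by norm_num)
  have h74 : Real.log (7 / 4) = Real.log 7 - 2 * Real.log 2 := by
    rw [Real.log_div (by norm_num) (by norm_num), show (4 : ℝ) = 2 ^ 2 by norm_num, Real.log_pow]
    norm_num
  have hl2 := Real.log_two_lt_d9
  have hl2' := Real.log_two_gt_d9
  have hl3 := log_three_halves_gt
  have hl7 := log_seven_fourths_gt
  rw [h32] at hl3
  rw [h74] at hl7
  rw [h83, h2116] at hmono
  rw [h6]
  norm_num at hl2 hl2' hl3 hl7 hmono ⊢
  linarith

end Literature.NumberTheory.Sieve.Chen
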